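import Summits.BirchSwinnertonDyer.Rank1Residual.GaloisImage.VisibleIndexBudgetPilot
import HarnessLib

/-!
# T-IDX27-REC (FILE 4): `Ш(E)[3] ≠ 0` for the PASS-rank3 rows `90648d1 ~ 271944b1`, `95184d1 ~ 285552b1`, `121032g1 ~ 363096d1` by the COUNT road with
# kernel index certificates `27 ≤ [E′(ℚ):3E′(ℚ)]` (team n1011, seat p17 lineage, row T-IDX27-REC; D15's shape)

HONEST FRAMING (cell `b2b-bsdres`, run/shared/lean/b2b/bsd-rank1-residual/, verbatim in every
file): the goal of the cell is to DELETE the COMBINATION-SHAPED residual classes of the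
Birch–Swinnerton-Dyer formula for ALL analytic-rank `≤ 1` elliptic curves over `ℚ` — "full BSD
formula for every rank `≤ 1` curve in class `C`" assembled STRICTLY from published theorems — so
that the rank-`≤ 1` remainder becomes exactly the CONSTRUCTION-SHAPED classes, which are TYPED
(missing-input `Prop`s), NOT attempted. This is not "finishing BSD". Team n1011 (N10/N11): research
route; this file is a set of per-pair KERNEL INSTANCES (EVIDENCE level: each record proves
`Ш(E)[3] ≠ 0` for ONE pair GIVEN `θ`, finiteness and coprimality — it closes nothing by itself; the
BSDp record with its EVIDENCE binders is the records lanes'); nothing is booked; no mark / label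
moved; X4 stays CONSTRUCTION-SHAPED. THEOREMS only; no definition, no named fact, no `sorry`.

## What

For each of r1's PASS-rank3 rows `E ~ E′` below (`route1/g29_cvis_pairs.tsv`: `E` an X4 curve with
`r_an = 0`, `E′` a `3`-congruent partner of Mordell–Weil rank `3`; inputs
`HOME/b2b-bsdres-n1011-p17/gen9/census/T-IDX27-PASSRANK3-INPUTS.md`, all 27/27 specified; the two
pilot rows are FILE D15 `GaloisImage/VisibleIndexBudgetPilot.lean`), token-for-token the pilot's recipe:
* ONE index instance `twentyseven_le_index_<E′>` — `27 ≤ [E′(ℚ):3E′(ℚ)]` by FILE D11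
  `twentyseven_le_index_range_zsmul_three_of_checks` from three Cremona generators, the ten compound
  points and thirteen NO-prime certificates `threeNonDivCheckAt … = true` (`decide +kernel`), the
  thirteen points checked ON the curve by `norm_num`;
* ONE record `exists_sha_three_torsion_<E>` over FILE D13
  `exists_sha_three_torsion_of_congr_of_index_of_primeList`: `L ⊇ primes(Δ_E Δ_E′) ∪ {3}` by x11c's
  factorisation certificates `X11b.forall_mem_of_natAbs_eq_prod_pow`, `#E′(ℚ_q)[3] = 1` at the free
  places `q ≠ 3` by T-LOC3L FILE L5 certificates (`threeTorsionCheckAt … = some 0`), the costly place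
  `3` by FILE D14 `natCard_ker_nsmul_three_adicCompletion_le_three_at3` (`μ₃(ℚ₃) = 1`, Weil pairing —
  no certificate, `t = 3`), budget `3 · 3 = 9 < 27`.
Displayed (NOT discharged): `θ : E′[3] ≅ E[3]` with `hθ`, `Finite E(ℚ)`, `(#E(ℚ), 3) = 1` — the
binder list is exactly the pilot's `(W W′ hW hW′ θ hθ hfin hcop)`.

Rows in this file: `90648d1 ~ 271944b1` (`E₀ = [0, 0, 0, 2517, 4561670]`, `F₀ = [0, 0, 0, -111, 146]`, `L = [2, 3, 1259]`); `95184d1 ~ 285552b1` (`E₀ = [0, 0, 0, 9359061, -5944037254]`, `F₀ = [0, 0, 0, -1659, 25994]`, `L = [2, 3, 661]`); `121032g1 ~ 363096d1` (`E₀ = [0, 0, 0, -3514971, -1158562010]`, `F₀ = [0, 0, 0, -246, 1681]`, `L = [2, 3, 41]`).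

References: [CremonaMazur2000] §3; [AgasheStein2002] Thm. 3.1; [Cremona2006] (labels).
-/

set_option autoImplicit false

open WeierstrassCurve NumberField IsDedekindDomain Rat.HeightOneSpectrum Field
  Literature.NumberTheory.EllipticCurves Literature.NumberTheory.GaloisRepresentations
open Summit.BirchSwinnertonDyer.Rank1Residual.GaloisImage.LocalTorsion3At
  (threeTorsionCheckAt natCard_ker_nsmul_three_adicCompletion_eq_of_checkAt)
open Summit.BirchSwinnertonDyer.Rank1Residual

namespace Summit.BirchSwinnertonDyer.Rank1Residual.GaloisImage.DivisionDecider

/-- **Index instance `271944b1`** (`[0, 0, 0, -111, 146]`, Cremona rank 3; r1 PASS-rank3 row `90648d1 ~ 271944b1`):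
generators `(1, 6)`, `(-5, 24)`, `(-11, 6)`, the ten compound points `P₁±P₂, P₁±P₃, P₂±P₃, (P₁+P₂)±P₃,
(P₁−P₂)±P₃` and thirteen NO-primes `[3, 3, 3, 3, 13, 3, 13, 3, 13, 19, 3, 3, 3]` (census `gen9/census/idx27_certs.json`); the
thirteen points checked ON the curve by `norm_num` (`nonsingular_of_eq`), chords and certificates by
`decide +kernel` after `clear d`. [folklore] -/
theorem twentyseven_le_index_271944b1 (W' : WeierstrassCurve ℚ) [W'.IsElliptic]
    (hW' : W' = ⟨0, 0, 0, -111, 146⟩) (d : DecidableEq ℚ) :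
    27 ≤ (letI : DecidableEq ℚ := d
      (zsmulAddGroupHom ((3 : ℕ) : ℤ) : W'.toAffine.Point →+ W'.toAffine.Point).range.index) :=
  twentyseven_le_index_range_zsmul_three_of_checks 0 0 0 (-111) 146 W' hW'
    (x₁ := 1) (y₁ := 6) (x₂ := (-5)) (y₂ := 24)
    (x₃ := (-11)) (y₃ := 6)
    (u₁ := 13) (v₁ := 30)
    (u₂ := 29) (v₂ := (-146))
    (u₃ := 10) (v₃ := (-6))
    (u₄ := 11) (v₄ := (-16))
    (u₅ := 25) (v₅ := (-114))
    (u₆ := 41) (v₆ := (-254))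
    (u₇ := (-1)) (v₇ := (-16))
    (u₈ := (1 / 4)) (v₈ := (-87 / 8))
    (u₉ := (-89 / 25)) (v₉ := (2784 / 125))
    (u₁₀ := (-23 / 4)) (v₁₀ := (195 / 8))
    (nonsingular_of_eq W' (by clear d; subst hW'; norm_num))
    (nonsingular_of_eq W' (by clear d; subst hW'; norm_num))
    (nonsingular_of_eq W' (by clear d; subst hW'; norm_num))
    (nonsingular_of_eq W' (by clear d; subst hW'; norm_num))
    (nonsingular_of_eq W' (by clear d; subst hW'; norm_num))
    (nonsingular_of_eq W' (by clear d; subst hW'; norm_num))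
    (nonsingular_of_eq W' (by clear d; subst hW'; norm_num))
    (nonsingular_of_eq W' (by clear d; subst hW'; norm_num))
    (nonsingular_of_eq W' (by clear d; subst hW'; norm_num))
    (nonsingular_of_eq W' (by clear d; subst hW'; norm_num))
    (nonsingular_of_eq W' (by clear d; subst hW'; norm_num))
    (nonsingular_of_eq W' (by clear d; subst hW'; norm_num))
    (nonsingular_of_eq W' (by clear d; subst hW'; norm_num))
    (by norm_num) (by norm_num) (by norm_num) (by norm_num) (by norm_num)
    (by clear d; subst hW'; decide +kernel) (by clear d; subst hW'; decide +kernel)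
    (by clear d; subst hW'; decide +kernel) (by clear d; subst hW'; decide +kernel)
    (by clear d; subst hW'; decide +kernel) (by clear d; subst hW'; decide +kernel)
    (by clear d; subst hW'; decide +kernel) (by clear d; subst hW'; decide +kernel)
    (by clear d; subst hW'; decide +kernel) (by clear d; subst hW'; decide +kernel)
    (by clear d; subst hW'; decide +kernel) (by clear d; subst hW'; decide +kernel)
    (by clear d; subst hW'; decide +kernel) (by clear d; subst hW'; decide +kernel)
    (by clear d; subst hW'; decide +kernel) (by clear d; subst hW'; decide +kernel)
    (by clear d; subst hW'; decide +kernel) (by clear d; subst hW'; decide +kernel)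
    (by clear d; subst hW'; decide +kernel) (by clear d; subst hW'; decide +kernel)
    (ℓ₁ := 3) (ℓ₂ := 3) (ℓ₃ := 3) (ℓ₄ := 3) (ℓ₅ := 13) (ℓ₆ := 3) (ℓ₇ := 13) (ℓ₈ := 3) (ℓ₉ := 13) (ℓ₁₀ := 19) (ℓ₁₁ := 3) (ℓ₁₂ := 3) (ℓ₁₃ := 3)
    (hℓ₁ := ⟨Nat.prime_three⟩) (hℓ₂ := ⟨Nat.prime_three⟩) (hℓ₃ := ⟨Nat.prime_three⟩)
    (hℓ₄ := ⟨Nat.prime_three⟩) (hℓ₅ := ⟨by norm_num⟩) (hℓ₆ := ⟨Nat.prime_three⟩)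
    (hℓ₇ := ⟨by norm_num⟩) (hℓ₈ := ⟨Nat.prime_three⟩) (hℓ₉ := ⟨by norm_num⟩)
    (hℓ₁₀ := ⟨by norm_num⟩) (hℓ₁₁ := ⟨Nat.prime_three⟩) (hℓ₁₂ := ⟨Nat.prime_three⟩)
    (hℓ₁₃ := ⟨Nat.prime_three⟩)
    (k₁ := 1) (k₂ := 1) (k₃ := 1) (k₄ := 1) (k₅ := 1) (k₆ := 1) (k₇ := 1) (k₈ := 1) (k₉ := 1) (k₁₀ := 1) (k₁₁ := 1) (k₁₂ := 1) (k₁₃ := 1)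
    (by decide +kernel) (by decide +kernel) (by decide +kernel) (by decide +kernel)
    (by decide +kernel) (by decide +kernel) (by decide +kernel) (by decide +kernel)
    (by decide +kernel) (by decide +kernel) (by decide +kernel) (by decide +kernel)
    (by decide +kernel) d

/-- **T-IDX27-REC `90648d1 ~ 271944b1` (PASS-rank3, `L = [2, 3, 1259]`): `Ш(E/ℚ)[3] ≠ 0` in the `hvis` currency** from
`θ`, `Finite E(ℚ)`, coprimality — everything else decided in the kernel: factorisation certificates
(`|Δ(E₀)| = 2^11·3^20·1259^1`, `|Δ(F₀)| = 2^8·3^5·1259^1`), `#E′(ℚ_q)[3] = 1` at `q ∈ [2, 1259]` by T-LOC3L L5 certificates, the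
place `3` by D14 (`μ₃(ℚ₃) = 1`, `t = 3`), the index certificate `twentyseven_le_index_271944b1`, budget `3·3 < 27`.
[cite: CremonaMazur2000, §3 pp. 19–22] [cite: Cremona2006, Table 1 (Cremona labels 90648d1, 271944b1)] -/
theorem exists_sha_three_torsion_90648d1 (W W' : WeierstrassCurve ℚ) [W.IsElliptic] [W'.IsElliptic]
    (hW : W = ⟨0, 0, 0, 2517, 4561670⟩) (hW' : W' = ⟨0, 0, 0, -111, 146⟩)
    (θ : geomTorsion W' ((3 : ℕ) : ℤ) ≃+ geomTorsion W ((3 : ℕ) : ℤ))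
    (hθ : ∀ (σ : Field.absoluteGaloisGroup ℚ) (P : geomTorsion W' ((3 : ℕ) : ℤ)),
      θ (σ • P) = σ • θ P)
    (hfin : Finite W.toAffine.Point) (hcop : (Nat.card W.toAffine.Point).Coprime 3) :
    ∃ c : W.sha, c ≠ 0 ∧ (3 : ℕ) • c = 0 := by
  haveI : Fact (Nat.Prime 2) := ⟨Nat.prime_two⟩
  haveI : Fact (Nat.Prime 1259) := ⟨by norm_num⟩
  have hidx := twentyseven_le_index_271944b1 W' hW' (fun a b => Classical.propDecidable (a = b))
  refine exists_sha_three_torsion_of_congr_of_index_of_primeList W W' θ hθ hfin hcop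
    (E₀ := ⟨0, 0, 0, 2517, 4561670⟩) (F₀ := ⟨0, 0, 0, -111, 146⟩)
    (by subst hW; ext <;> simp [WeierstrassCurve.map])
    (by subst hW'; ext <;> simp [WeierstrassCurve.map])
    [2, 3, 1259] (by decide)
    (X11b.forall_mem_of_natAbs_eq_prod_pow [2, 3, 1259] [11, 20, 1]
      (by intro q hq; simp only [List.mem_cons, List.mem_nil_iff, or_false] at hq; rcases hq with rfl | rfl | rfl <;> norm_num)
      (by decide +kernel))
    (X11b.forall_mem_of_natAbs_eq_prod_pow [2, 3, 1259] [8, 5, 1]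
      (by intro q hq; simp only [List.mem_cons, List.mem_nil_iff, or_false] at hq; rcases hq with rfl | rfl | rfl <;> norm_num)
      (by decide +kernel))
    Nat.prime_three (by decide) (t := 3)
    (fun v hv => natCard_ker_nsmul_three_adicCompletion_le_three_at3 W' hv)
    (fun v hvL hv3 => ?_) (m := 27) (by norm_num) hidx
  have hcases : (primesEquiv v : ℕ) = 2 ∨ (primesEquiv v : ℕ) = 1259 := by
    simp only [List.mem_cons, List.mem_nil_iff, or_false] at hvL
    omega
  rcases hcases with h2 | h1259
  · exact (natCard_ker_nsmul_three_adicCompletion_eq_of_checkAt 2 0 0 0 (-111) 146 (by norm_num)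
      (by decide) (k := 2) (S := 0) (cert := []) (by decide +kernel) W' hW' h2).trans
      (by norm_num)
  · exact (natCard_ker_nsmul_three_adicCompletion_eq_of_checkAt 1259 0 0 0 (-111) 146 (by norm_num)
      (by decide) (k := 1) (S := 0) (cert := [((1151 : ℤ), 0, 1, 0)]) (by decide +kernel) W' hW' h1259).trans
      (by norm_num)

/-- **Index instance `285552b1`** (`[0, 0, 0, -1659, 25994]`, Cremona rank 3; r1 PASS-rank3 row `95184d1 ~ 285552b1`):
generators `(25, 12)`, `(23, 2)`, `(22, 12)`, the ten compound points `P₁±P₂, P₁±P₃, P₂±P₃, (P₁+P₂)±P₃,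
(P₁−P₂)±P₃` and thirteen NO-primes `[3, 17, 3, 3, 3, 3, 5, 3, 3, 3, 5, 3, 5]` (census `gen9/census/idx27_certs.json`); the
thirteen points checked ON the curve by `norm_num` (`nonsingular_of_eq`), chords and certificates by
`decide +kernel` after `clear d`. [folklore] -/
theorem twentyseven_le_index_285552b1 (W' : WeierstrassCurve ℚ) [W'.IsElliptic]
    (hW' : W' = ⟨0, 0, 0, -1659, 25994⟩) (d : DecidableEq ℚ) :
    27 ≤ (letI : DecidableEq ℚ := d
      (zsmulAddGroupHom ((3 : ℕ) : ℤ) : W'.toAffine.Point →+ W'.toAffine.Point).range.index) :=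
  twentyseven_le_index_range_zsmul_three_of_checks 0 0 0 (-1659) 25994 W' hW'
    (x₁ := 25) (y₁ := 12) (x₂ := 23) (y₂ := 2)
    (x₃ := 22) (y₃ := 12)
    (u₁ := (-23)) (v₁ := 228)
    (u₂ := 1) (v₂ := 156)
    (u₃ := (-47)) (v₃ := (-12))
    (u₄ := 17) (v₄ := 52)
    (u₅ := 55) (v₅ := 318)
    (u₆ := 151) (v₆ := (-1794))
    (u₇ := (601 / 25)) (v₇ := (-276 / 125))
    (u₈ := (265 / 9)) (v₈ := (1396 / 27))
    (u₉ := (1177 / 49)) (v₉ := (636 / 343))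
    (u₁₀ := 41) (v₁₀ := 164)
    (nonsingular_of_eq W' (by clear d; subst hW'; norm_num))
    (nonsingular_of_eq W' (by clear d; subst hW'; norm_num))
    (nonsingular_of_eq W' (by clear d; subst hW'; norm_num))
    (nonsingular_of_eq W' (by clear d; subst hW'; norm_num))
    (nonsingular_of_eq W' (by clear d; subst hW'; norm_num))
    (nonsingular_of_eq W' (by clear d; subst hW'; norm_num))
    (nonsingular_of_eq W' (by clear d; subst hW'; norm_num))
    (nonsingular_of_eq W' (by clear d; subst hW'; norm_num))
    (nonsingular_of_eq W' (by clear d; subst hW'; norm_num))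
    (nonsingular_of_eq W' (by clear d; subst hW'; norm_num))
    (nonsingular_of_eq W' (by clear d; subst hW'; norm_num))
    (nonsingular_of_eq W' (by clear d; subst hW'; norm_num))
    (nonsingular_of_eq W' (by clear d; subst hW'; norm_num))
    (by norm_num) (by norm_num) (by norm_num) (by norm_num) (by norm_num)
    (by clear d; subst hW'; decide +kernel) (by clear d; subst hW'; decide +kernel)
    (by clear d; subst hW'; decide +kernel) (by clear d; subst hW'; decide +kernel)
    (by clear d; subst hW'; decide +kernel) (by clear d; subst hW'; decide +kernel)
    (by clear d; subst hW'; decide +kernel) (by clear d; subst hW'; decide +kernel)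
    (by clear d; subst hW'; decide +kernel) (by clear d; subst hW'; decide +kernel)
    (by clear d; subst hW'; decide +kernel) (by clear d; subst hW'; decide +kernel)
    (by clear d; subst hW'; decide +kernel) (by clear d; subst hW'; decide +kernel)
    (by clear d; subst hW'; decide +kernel) (by clear d; subst hW'; decide +kernel)
    (by clear d; subst hW'; decide +kernel) (by clear d; subst hW'; decide +kernel)
    (by clear d; subst hW'; decide +kernel) (by clear d; subst hW'; decide +kernel)
    (ℓ₁ := 3) (ℓ₂ := 17) (ℓ₃ := 3) (ℓ₄ := 3) (ℓ₅ := 3) (ℓ₆ := 3) (ℓ₇ := 5) (ℓ₈ := 3) (ℓ₉ := 3) (ℓ₁₀ := 3) (ℓ₁₁ := 5) (ℓ₁₂ := 3) (ℓ₁₃ := 5)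
    (hℓ₁ := ⟨Nat.prime_three⟩) (hℓ₂ := ⟨by norm_num⟩) (hℓ₃ := ⟨Nat.prime_three⟩)
    (hℓ₄ := ⟨Nat.prime_three⟩) (hℓ₅ := ⟨Nat.prime_three⟩) (hℓ₆ := ⟨Nat.prime_three⟩)
    (hℓ₇ := ⟨by norm_num⟩) (hℓ₈ := ⟨Nat.prime_three⟩) (hℓ₉ := ⟨Nat.prime_three⟩)
    (hℓ₁₀ := ⟨Nat.prime_three⟩) (hℓ₁₁ := ⟨by norm_num⟩) (hℓ₁₂ := ⟨Nat.prime_three⟩)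
    (hℓ₁₃ := ⟨by norm_num⟩)
    (k₁ := 1) (k₂ := 1) (k₃ := 1) (k₄ := 1) (k₅ := 1) (k₆ := 1) (k₇ := 1) (k₈ := 1) (k₉ := 1) (k₁₀ := 1) (k₁₁ := 1) (k₁₂ := 1) (k₁₃ := 1)
    (by decide +kernel) (by decide +kernel) (by decide +kernel) (by decide +kernel)
    (by decide +kernel) (by decide +kernel) (by decide +kernel) (by decide +kernel)
    (by decide +kernel) (by decide +kernel) (by decide +kernel) (by decide +kernel)
    (by decide +kernel) d

/-- **T-IDX27-REC `95184d1 ~ 285552b1` (PASS-rank3, `L = [2, 3, 661]`): `Ш(E/ℚ)[3] ≠ 0` in the `hvis` currency** from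
`θ`, `Finite E(ℚ)`, coprimality — everything else decided in the kernel: factorisation certificates
(`|Δ(E₀)| = 2^11·3^35·661^1`, `|Δ(F₀)| = 2^11·3^5·661^1`), `#E′(ℚ_q)[3] = 1` at `q ∈ [2, 661]` by T-LOC3L L5 certificates, the
place `3` by D14 (`μ₃(ℚ₃) = 1`, `t = 3`), the index certificate `twentyseven_le_index_285552b1`, budget `3·3 < 27`.
[cite: CremonaMazur2000, §3 pp. 19–22] [cite: Cremona2006, Table 1 (Cremona labels 95184d1, 285552b1)] -/
theorem exists_sha_three_torsion_95184d1 (W W' : WeierstrassCurve ℚ) [W.IsElliptic] [W'.IsElliptic]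
    (hW : W = ⟨0, 0, 0, 9359061, -5944037254⟩) (hW' : W' = ⟨0, 0, 0, -1659, 25994⟩)
    (θ : geomTorsion W' ((3 : ℕ) : ℤ) ≃+ geomTorsion W ((3 : ℕ) : ℤ))
    (hθ : ∀ (σ : Field.absoluteGaloisGroup ℚ) (P : geomTorsion W' ((3 : ℕ) : ℤ)),
      θ (σ • P) = σ • θ P)
    (hfin : Finite W.toAffine.Point) (hcop : (Nat.card W.toAffine.Point).Coprime 3) :
    ∃ c : W.sha, c ≠ 0 ∧ (3 : ℕ) • c = 0 := by
  haveI : Fact (Nat.Prime 2) := ⟨Nat.prime_two⟩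
  haveI : Fact (Nat.Prime 661) := ⟨by norm_num⟩
  have hidx := twentyseven_le_index_285552b1 W' hW' (fun a b => Classical.propDecidable (a = b))
  refine exists_sha_three_torsion_of_congr_of_index_of_primeList W W' θ hθ hfin hcop
    (E₀ := ⟨0, 0, 0, 9359061, -5944037254⟩) (F₀ := ⟨0, 0, 0, -1659, 25994⟩)
    (by subst hW; ext <;> simp [WeierstrassCurve.map])
    (by subst hW'; ext <;> simp [WeierstrassCurve.map])
    [2, 3, 661] (by decide)
    (X11b.forall_mem_of_natAbs_eq_prod_pow [2, 3, 661] [11, 35, 1]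
      (by intro q hq; simp only [List.mem_cons, List.mem_nil_iff, or_false] at hq; rcases hq with rfl | rfl | rfl <;> norm_num)
      (by decide +kernel))
    (X11b.forall_mem_of_natAbs_eq_prod_pow [2, 3, 661] [11, 5, 1]
      (by intro q hq; simp only [List.mem_cons, List.mem_nil_iff, or_false] at hq; rcases hq with rfl | rfl | rfl <;> norm_num)
      (by decide +kernel))
    Nat.prime_three (by decide) (t := 3)
    (fun v hv => natCard_ker_nsmul_three_adicCompletion_le_three_at3 W' hv)
    (fun v hvL hv3 => ?_) (m := 27) (by norm_num) hidx
  have hcases : (primesEquiv v : ℕ) = 2 ∨ (primesEquiv v : ℕ) = 661 := by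
    simp only [List.mem_cons, List.mem_nil_iff, or_false] at hvL
    omega
  rcases hcases with h2 | h661
  · exact (natCard_ker_nsmul_three_adicCompletion_eq_of_checkAt 2 0 0 0 (-1659) 25994 (by norm_num)
      (by decide) (k := 2) (S := 0) (cert := []) (by decide +kernel) W' hW' h2).trans
      (by norm_num)
  · exact (natCard_ker_nsmul_three_adicCompletion_eq_of_checkAt 661 0 0 0 (-1659) 25994 (by norm_num)
      (by decide) (k := 1) (S := 0) (cert := [((563 : ℤ), 0, 1, 0)]) (by decide +kernel) W' hW' h661).trans
      (by norm_num)

/-- **Index instance `363096d1`** (`[0, 0, 0, -246, 1681]`, Cremona rank 3; r1 PASS-rank3 row `121032g1 ~ 363096d1`):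
generators `(0, 41)`, `(41, 246)`, `(41/4, 123/8)`, the ten compound points `P₁±P₂, P₁±P₃, P₂±P₃, (P₁+P₂)±P₃,
(P₁−P₂)±P₃` and thirteen NO-primes `[17, 3, 3, 3, 3, 3, 3, 3, 3, 3, 3, 17, 3]` (census `gen9/census/idx27_certs.json`); the
thirteen points checked ON the curve by `norm_num` (`nonsingular_of_eq`), chords and certificates by
`decide +kernel` after `clear d`. [folklore] -/
theorem twentyseven_le_index_363096d1 (W' : WeierstrassCurve ℚ) [W'.IsElliptic]
    (hW' : W' = ⟨0, 0, 0, -246, 1681⟩) (d : DecidableEq ℚ) :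
    27 ≤ (letI : DecidableEq ℚ := d
      (zsmulAddGroupHom ((3 : ℕ) : ℤ) : W'.toAffine.Point →+ W'.toAffine.Point).range.index) :=
  twentyseven_le_index_range_zsmul_three_of_checks 0 0 0 (-246) 1681 W' hW'
    (x₁ := 0) (y₁ := 41) (x₂ := 41) (y₂ := 246)
    (x₃ := (41 / 4)) (y₃ := (123 / 8))
    (u₁ := (-16)) (v₁ := 39)
    (u₂ := 8) (v₂ := 15)
    (u₃ := (-4)) (v₃ := (-51))
    (u₄ := 20) (v₄ := 69)
    (u₅ := 5) (v₅ := 24)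
    (u₆ := 21) (v₆ := (-76))
    (u₇ := (164 / 25)) (v₇ := (-2337 / 125))
    (u₈ := (492 / 49)) (v₈ := (5125 / 343))
    (u₉ := (-164 / 9)) (v₉ := (-287 / 27))
    (u₁₀ := 164) (v₁₀ := 2091)
    (nonsingular_of_eq W' (by clear d; subst hW'; norm_num))
    (nonsingular_of_eq W' (by clear d; subst hW'; norm_num))
    (nonsingular_of_eq W' (by clear d; subst hW'; norm_num))
    (nonsingular_of_eq W' (by clear d; subst hW'; norm_num))
    (nonsingular_of_eq W' (by clear d; subst hW'; norm_num))
    (nonsingular_of_eq W' (by clear d; subst hW'; norm_num))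
    (nonsingular_of_eq W' (by clear d; subst hW'; norm_num))
    (nonsingular_of_eq W' (by clear d; subst hW'; norm_num))
    (nonsingular_of_eq W' (by clear d; subst hW'; norm_num))
    (nonsingular_of_eq W' (by clear d; subst hW'; norm_num))
    (nonsingular_of_eq W' (by clear d; subst hW'; norm_num))
    (nonsingular_of_eq W' (by clear d; subst hW'; norm_num))
    (nonsingular_of_eq W' (by clear d; subst hW'; norm_num))
    (by norm_num) (by norm_num) (by norm_num) (by norm_num) (by norm_num)
    (by clear d; subst hW'; decide +kernel) (by clear d; subst hW'; decide +kernel)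
    (by clear d; subst hW'; decide +kernel) (by clear d; subst hW'; decide +kernel)
    (by clear d; subst hW'; decide +kernel) (by clear d; subst hW'; decide +kernel)
    (by clear d; subst hW'; decide +kernel) (by clear d; subst hW'; decide +kernel)
    (by clear d; subst hW'; decide +kernel) (by clear d; subst hW'; decide +kernel)
    (by clear d; subst hW'; decide +kernel) (by clear d; subst hW'; decide +kernel)
    (by clear d; subst hW'; decide +kernel) (by clear d; subst hW'; decide +kernel)
    (by clear d; subst hW'; decide +kernel) (by clear d; subst hW'; decide +kernel)
    (by clear d; subst hW'; decide +kernel) (by clear d; subst hW'; decide +kernel)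
    (by clear d; subst hW'; decide +kernel) (by clear d; subst hW'; decide +kernel)
    (ℓ₁ := 17) (ℓ₂ := 3) (ℓ₃ := 3) (ℓ₄ := 3) (ℓ₅ := 3) (ℓ₆ := 3) (ℓ₇ := 3) (ℓ₈ := 3) (ℓ₉ := 3) (ℓ₁₀ := 3) (ℓ₁₁ := 3) (ℓ₁₂ := 17) (ℓ₁₃ := 3)
    (hℓ₁ := ⟨by norm_num⟩) (hℓ₂ := ⟨Nat.prime_three⟩) (hℓ₃ := ⟨Nat.prime_three⟩)
    (hℓ₄ := ⟨Nat.prime_three⟩) (hℓ₅ := ⟨Nat.prime_three⟩) (hℓ₆ := ⟨Nat.prime_three⟩)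
    (hℓ₇ := ⟨Nat.prime_three⟩) (hℓ₈ := ⟨Nat.prime_three⟩) (hℓ₉ := ⟨Nat.prime_three⟩)
    (hℓ₁₀ := ⟨Nat.prime_three⟩) (hℓ₁₁ := ⟨Nat.prime_three⟩) (hℓ₁₂ := ⟨by norm_num⟩)
    (hℓ₁₃ := ⟨Nat.prime_three⟩)
    (k₁ := 1) (k₂ := 1) (k₃ := 1) (k₄ := 1) (k₅ := 1) (k₆ := 1) (k₇ := 1) (k₈ := 1) (k₉ := 2) (k₁₀ := 1) (k₁₁ := 2) (k₁₂ := 1) (k₁₃ := 1)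
    (by decide +kernel) (by decide +kernel) (by decide +kernel) (by decide +kernel)
    (by decide +kernel) (by decide +kernel) (by decide +kernel) (by decide +kernel)
    (by decide +kernel) (by decide +kernel) (by decide +kernel) (by decide +kernel)
    (by decide +kernel) d

/-- **T-IDX27-REC `121032g1 ~ 363096d1` (PASS-rank3, `L = [2, 3, 41]`): `Ш(E/ℚ)[3] ≠ 0` in the `hvis` currency** from
`θ`, `Finite E(ℚ)`, coprimality — everything else decided in the kernel: factorisation certificates
(`|Δ(E₀)| = 2^10·3^8·41^9`, `|Δ(F₀)| = 2^4·3^5·41^3`), `#E′(ℚ_q)[3] = 1` at `q ∈ [2, 41]` by T-LOC3L L5 certificates, the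
place `3` by D14 (`μ₃(ℚ₃) = 1`, `t = 3`), the index certificate `twentyseven_le_index_363096d1`, budget `3·3 < 27`.
[cite: CremonaMazur2000, §3 pp. 19–22] [cite: Cremona2006, Table 1 (Cremona labels 121032g1, 363096d1)] -/
theorem exists_sha_three_torsion_121032g1 (W W' : WeierstrassCurve ℚ) [W.IsElliptic] [W'.IsElliptic]
    (hW : W = ⟨0, 0, 0, -3514971, -1158562010⟩) (hW' : W' = ⟨0, 0, 0, -246, 1681⟩)
    (θ : geomTorsion W' ((3 : ℕ) : ℤ) ≃+ geomTorsion W ((3 : ℕ) : ℤ))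
    (hθ : ∀ (σ : Field.absoluteGaloisGroup ℚ) (P : geomTorsion W' ((3 : ℕ) : ℤ)),
      θ (σ • P) = σ • θ P)
    (hfin : Finite W.toAffine.Point) (hcop : (Nat.card W.toAffine.Point).Coprime 3) :
    ∃ c : W.sha, c ≠ 0 ∧ (3 : ℕ) • c = 0 := by
  haveI : Fact (Nat.Prime 2) := ⟨Nat.prime_two⟩
  haveI : Fact (Nat.Prime 41) := ⟨by norm_num⟩
  have hidx := twentyseven_le_index_363096d1 W' hW' (fun a b => Classical.propDecidable (a = b))
  refine exists_sha_three_torsion_of_congr_of_index_of_primeList W W' θ hθ hfin hcop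
    (E₀ := ⟨0, 0, 0, -3514971, -1158562010⟩) (F₀ := ⟨0, 0, 0, -246, 1681⟩)
    (by subst hW; ext <;> simp [WeierstrassCurve.map])
    (by subst hW'; ext <;> simp [WeierstrassCurve.map])
    [2, 3, 41] (by decide)
    (X11b.forall_mem_of_natAbs_eq_prod_pow [2, 3, 41] [10, 8, 9]
      (by intro q hq; simp only [List.mem_cons, List.mem_nil_iff, or_false] at hq; rcases hq with rfl | rfl | rfl <;> norm_num)
      (by decide +kernel))
    (X11b.forall_mem_of_natAbs_eq_prod_pow [2, 3, 41] [4, 5, 3]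
      (by intro q hq; simp only [List.mem_cons, List.mem_nil_iff, or_false] at hq; rcases hq with rfl | rfl | rfl <;> norm_num)
      (by decide +kernel))
    Nat.prime_three (by decide) (t := 3)
    (fun v hv => natCard_ker_nsmul_three_adicCompletion_le_three_at3 W' hv)
    (fun v hvL hv3 => ?_) (m := 27) (by norm_num) hidx
  have hcases : (primesEquiv v : ℕ) = 2 ∨ (primesEquiv v : ℕ) = 41 := by
    simp only [List.mem_cons, List.mem_nil_iff, or_false] at hvL
    omega
  rcases hcases with h2 | h41
  · exact (natCard_ker_nsmul_three_adicCompletion_eq_of_checkAt 2 0 0 0 (-246) 1681 (by norm_num)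
      (by decide) (k := 1) (S := 0) (cert := []) (by decide +kernel) W' hW' h2).trans
      (by norm_num)
  · exact (natCard_ker_nsmul_three_adicCompletion_eq_of_checkAt 41 0 0 0 (-246) 1681 (by norm_num)
      (by decide) (k := 1) (S := 0) (cert := []) (by decide +kernel) W' hW' h41).trans
      (by norm_num)

end Summit.BirchSwinnertonDyer.Rank1Residual.GaloisImage.DivisionDecider
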